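import Mathlib
import Summits.Ventures.PercRepro2.Defs
import Summits.Ventures.PercRepro2.Harris
import Summits.Ventures.PercRepro2.Graph
import Summits.Ventures.PercRepro2.Events
import Summits.Ventures.PercRepro2.BHKAvoidWeighted
import Summits.Ventures.PercRepro2.PsiPendantLemmas
import Summits.Ventures.PercRepro2.PsiUniSure
import Summits.Ventures.PercRepro2.PsiUniExplored
import Summits.Ventures.PercRepro2.PsiBernstein
import Summits.Ventures.PercRepro2.PsiTEdge

/-!
# (BERN_f) for the edge at the explored `t`-component that reaches the mark `o` (PercRepro2, p2)

Let `f` with `ends f = s(t', o)` be the only unpinned edge at the explored `t`-component `Λ` of `p`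
(`t' ∈ Λ`; `s, o ∉ Λ`).  The two worlds of `PsiTEdge.lean` give the sixteen pinned masses of the
(Ψ)-slack: with `f` closed, `Q` is sure and `o ∉ C_t`; with `f` open, `o ∈ C_t` is sure, `Q` is
`{s ↮ o}` of the closed world and the cluster of `s` is unchanged on it.  Writing `N = P⁰(s ↮ o)`,
`Su = P⁰(s ↔ u)`, `SuN = P⁰(s ↔ u, s ↮ o)`, `Ug = P⁰(C_s ∈ 𝓤)`, `UgN = P⁰(C_s ∈ 𝓤, s ↮ o)`, the two
mixed Bernstein coefficients of `PsiBernstein.lean` collapse to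
`T₁ = (Su·N − SuN)·UgN + (Ug·N − UgN)` and `T₂ = N·(N·Ug − UgN)`, which are nonnegative by the mixed
Harris inequality (an increasing against a decreasing event) — P2-G18-BERN.md §7b (i).  So the
hypothesis of the frame `psi_slack_nonneg_of_bern_t` is met whenever the exploration reaches the mark.

* `tmark_pinned_eq` — pinning `f` closed does not change the explored component;
* `tmark_q_one`, `tmark_oL_one`, `tmark_oH_one`, `tmark_aH_one`, `tmark_oLH_one`, `tmark_oHH_one`,
  `tmark_Ug_one`, `tmark_oLU_one` — the eight masses with `f` pinned open, in the closed world;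
* `psi_bern_t_of_mark_o` — **`0 ≤ T₁` and `0 ≤ T₂` for the edge reaching `o`**.
-/

namespace Summit.Ventures.PercRepro2

section TMark

variable {V : Type*} {E : Type*} [Fintype E] [DecidableEq E]
  {R : Type*} [CommRing R] [LinearOrder R] [IsStrictOrderedRing R]

omit [Fintype E] [IsStrictOrderedRing R] in
/-- Pinning `f` closed (`p f ≠ 1`) does not change the pinned-open configuration. -/
lemma tmark_pinned_eq (p : E → R) (f : E) (hpf1 : p f ≠ 1) :
    (fun e => decide (Function.update p f 0 e = 1)) = fun e => decide (p e = 1) := by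
  funext e
  by_cases hef : e = f
  · subst hef
    by_cases h01 : (0 : R) = 1
    · exact absurd (@Subsingleton.elim R (subsingleton_of_zero_eq_one h01) (p e) 1) hpf1
    · simp [hpf1, h01]
  · rw [Function.update_of_ne hef]

omit [IsStrictOrderedRing R] in
/-- With `f` open, `Q = {s ↮ t}` is `{s ↮ o}` of the closed world. -/
lemma tmark_q_one (p : E → R) (ends : E → Sym2 V) (s t t' o : V) (f : E)
    (hf : ends f = s(t', o)) (ht' : Conn ends (fun e => decide (p e = 1)) t t')
    (hs : ¬ Conn ends (fun e => decide (p e = 1)) t s) (hpf1 : p f ≠ 1)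
    (hpin : ∀ e, e ≠ f → (∃ v ∈ ends e, Conn ends (fun e => decide (p e = 1)) t v) →
      p e = 0 ∨ p e = 1) :
    prob (Function.update p f 1) (connEvent ends s t)ᶜ =
      prob (Function.update p f 0) (connEvent ends s o)ᶜ := by
  refine prob_update_one_eq_prob_update_zero_of_respects p f fun ω h0 h1 => ?_
  simp only [Set.mem_compl_iff, mem_connEvent]
  exact not_congr (conn_update_true_s_t_iff hf ht' hs hpf1 hpin h0 h1)

omit [IsStrictOrderedRing R] in
/-- With `f` open, `o ∈ C_t` is sure on `Q`. -/
lemma tmark_oL_one (p : E → R) (ends : E → Sym2 V) (s t t' o : V) (f : E)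
    (hf : ends f = s(t', o)) (ht' : Conn ends (fun e => decide (p e = 1)) t t')
    (hs : ¬ Conn ends (fun e => decide (p e = 1)) t s) (hpf1 : p f ≠ 1)
    (hpin : ∀ e, e ≠ f → (∃ v ∈ ends e, Conn ends (fun e => decide (p e = 1)) t v) →
      p e = 0 ∨ p e = 1) :
    prob (Function.update p f 1) (clusterInEvent ends t {W : Set V | o ∈ W} ∩
      (connEvent ends s t)ᶜ) = prob (Function.update p f 0) (connEvent ends s o)ᶜ := by
  refine prob_update_one_eq_prob_update_zero_of_respects p f fun ω h0 h1 => ?_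
  simp only [Set.mem_inter_iff, mem_clusterInEvent, Set.mem_setOf_eq, mem_cluster,
    Set.mem_compl_iff, mem_connEvent]
  constructor
  · rintro ⟨_, h⟩
    exact (not_congr (conn_update_true_s_t_iff hf ht' hs hpf1 hpin h0 h1)).1 h
  · intro h
    exact ⟨(conn_update_true_t_iff hf ht' hpf1 hpin h0 h1 o).2 (Or.inr (conn_refl _ _ _)), (not_congr (conn_update_true_s_t_iff hf ht' hs hpf1 hpin h0 h1)).2 h⟩

omit [IsStrictOrderedRing R] in
/-- With `f` open, `o ∈ C_s` is null on `Q`. -/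
lemma tmark_oH_one (p : E → R) (ends : E → Sym2 V) (s t t' o : V) (f : E)
    (hf : ends f = s(t', o)) (ht' : Conn ends (fun e => decide (p e = 1)) t t')
    (hs : ¬ Conn ends (fun e => decide (p e = 1)) t s) (hpf1 : p f ≠ 1)
    (hpin : ∀ e, e ≠ f → (∃ v ∈ ends e, Conn ends (fun e => decide (p e = 1)) t v) →
      p e = 0 ∨ p e = 1) :
    prob (Function.update p f 1) (clusterInEvent ends s {W : Set V | o ∈ W} ∩
      (connEvent ends s t)ᶜ) = 0 := by
  rw [prob_update_one_eq_prob_update_zero_of_respects p f (A' := (∅ : Set (Config E)))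
    fun ω h0 h1 => ?_]
  · exact prob_empty _
  simp only [Set.mem_inter_iff, mem_clusterInEvent, Set.mem_setOf_eq, mem_cluster,
    Set.mem_compl_iff, mem_connEvent, Set.mem_empty_iff_false, iff_false, not_and, not_not]
  intro hso
  by_contra hst
  exact hst ((conn_update_true_s_t_iff hf ht' hs hpf1 hpin h0 h1).2 ((conn_update_true_s_iff_of_not_conn hf ht' hs hpf1 hpin h0 h1 hst o).1 hso))

omit [IsStrictOrderedRing R] in
/-- With `f` open, `{u ∈ C_s} ∩ Q` is `{s ↔ u, s ↮ o}` of the closed world. -/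
lemma tmark_aH_one (p : E → R) (ends : E → Sym2 V) (s t t' o u : V) (f : E)
    (hf : ends f = s(t', o)) (ht' : Conn ends (fun e => decide (p e = 1)) t t')
    (hs : ¬ Conn ends (fun e => decide (p e = 1)) t s) (hpf1 : p f ≠ 1)
    (hpin : ∀ e, e ≠ f → (∃ v ∈ ends e, Conn ends (fun e => decide (p e = 1)) t v) →
      p e = 0 ∨ p e = 1) :
    prob (Function.update p f 1) (connEvent ends s u ∩ (connEvent ends s t)ᶜ) =
      prob (Function.update p f 0) (connEvent ends s u ∩ (connEvent ends s o)ᶜ) := by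
  refine prob_update_one_eq_prob_update_zero_of_respects p f fun ω h0 h1 => ?_
  simp only [Set.mem_inter_iff, Set.mem_compl_iff, mem_connEvent]
  constructor
  · rintro ⟨hu, hst⟩
    exact ⟨(conn_update_true_s_iff_of_not_conn hf ht' hs hpf1 hpin h0 h1 hst u).1 hu, fun h => hst ((conn_update_true_s_t_iff hf ht' hs hpf1 hpin h0 h1).2 h)⟩
  · rintro ⟨hu, hso⟩
    have hst : ¬ Conn ends (Function.update ω f true) s t := fun h => hso ((conn_update_true_s_t_iff hf ht' hs hpf1 hpin h0 h1).1 h)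
    exact ⟨(conn_update_true_s_iff_of_not_conn hf ht' hs hpf1 hpin h0 h1 hst u).2 hu, hst⟩

omit [IsStrictOrderedRing R] in
/-- With `f` open, `{u ∈ C_s} ∩ {o ∈ C_t} ∩ Q` is `{s ↔ u, s ↮ o}` of the closed world. -/
lemma tmark_oLH_one (p : E → R) (ends : E → Sym2 V) (s t t' o u : V) (f : E)
    (hf : ends f = s(t', o)) (ht' : Conn ends (fun e => decide (p e = 1)) t t')
    (hs : ¬ Conn ends (fun e => decide (p e = 1)) t s) (hpf1 : p f ≠ 1)
    (hpin : ∀ e, e ≠ f → (∃ v ∈ ends e, Conn ends (fun e => decide (p e = 1)) t v) →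
      p e = 0 ∨ p e = 1) :
    prob (Function.update p f 1) (connEvent ends s u ∩ clusterInEvent ends t {W : Set V | o ∈ W} ∩
      (connEvent ends s t)ᶜ) =
      prob (Function.update p f 0) (connEvent ends s u ∩ (connEvent ends s o)ᶜ) := by
  refine prob_update_one_eq_prob_update_zero_of_respects p f fun ω h0 h1 => ?_
  simp only [Set.mem_inter_iff, mem_clusterInEvent, Set.mem_setOf_eq, mem_cluster,
    Set.mem_compl_iff, mem_connEvent]
  constructor
  · rintro ⟨⟨hu, _⟩, hst⟩
    exact ⟨(conn_update_true_s_iff_of_not_conn hf ht' hs hpf1 hpin h0 h1 hst u).1 hu, fun h => hst ((conn_update_true_s_t_iff hf ht' hs hpf1 hpin h0 h1).2 h)⟩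
  · rintro ⟨hu, hso⟩
    have hst : ¬ Conn ends (Function.update ω f true) s t := fun h => hso ((conn_update_true_s_t_iff hf ht' hs hpf1 hpin h0 h1).1 h)
    exact ⟨⟨(conn_update_true_s_iff_of_not_conn hf ht' hs hpf1 hpin h0 h1 hst u).2 hu, (conn_update_true_t_iff hf ht' hpf1 hpin h0 h1 o).2 (Or.inr (conn_refl _ _ _))⟩, hst⟩

omit [IsStrictOrderedRing R] in
/-- With `f` open, `{u ∈ C_s} ∩ {o ∈ C_s} ∩ Q` is null. -/
lemma tmark_oHH_one (p : E → R) (ends : E → Sym2 V) (s t t' o u : V) (f : E)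
    (hf : ends f = s(t', o)) (ht' : Conn ends (fun e => decide (p e = 1)) t t')
    (hs : ¬ Conn ends (fun e => decide (p e = 1)) t s) (hpf1 : p f ≠ 1)
    (hpin : ∀ e, e ≠ f → (∃ v ∈ ends e, Conn ends (fun e => decide (p e = 1)) t v) →
      p e = 0 ∨ p e = 1) :
    prob (Function.update p f 1) (connEvent ends s u ∩ clusterInEvent ends s {W : Set V | o ∈ W} ∩
      (connEvent ends s t)ᶜ) = 0 := by
  rw [prob_update_one_eq_prob_update_zero_of_respects p f (A' := (∅ : Set (Config E)))
    fun ω h0 h1 => ?_]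
  · exact prob_empty _
  simp only [Set.mem_inter_iff, mem_clusterInEvent, Set.mem_setOf_eq, mem_cluster,
    Set.mem_compl_iff, mem_connEvent, Set.mem_empty_iff_false, iff_false, not_and, not_not]
  rintro ⟨_, hso⟩
  by_contra hst
  exact hst ((conn_update_true_s_t_iff hf ht' hs hpf1 hpin h0 h1).2 ((conn_update_true_s_iff_of_not_conn hf ht' hs hpf1 hpin h0 h1 hst o).1 hso))

omit [IsStrictOrderedRing R] in
/-- With `f` open, `{C_s ∈ 𝓤} ∩ Q` is `{C_s ∈ 𝓤, s ↮ o}` of the closed world. -/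
lemma tmark_Ug_one (p : E → R) (ends : E → Sym2 V) (s t t' o : V) (f : E)
    (hf : ends f = s(t', o)) (ht' : Conn ends (fun e => decide (p e = 1)) t t')
    (hs : ¬ Conn ends (fun e => decide (p e = 1)) t s) (hpf1 : p f ≠ 1)
    (hpin : ∀ e, e ≠ f → (∃ v ∈ ends e, Conn ends (fun e => decide (p e = 1)) t v) →
      p e = 0 ∨ p e = 1) (𝓤 : Set (Set V)) :
    prob (Function.update p f 1) (clusterInEvent ends s 𝓤 ∩ (connEvent ends s t)ᶜ) =
      prob (Function.update p f 0) (clusterInEvent ends s 𝓤 ∩ (connEvent ends s o)ᶜ) := by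
  refine prob_update_one_eq_prob_update_zero_of_respects p f fun ω h0 h1 => ?_
  simp only [Set.mem_inter_iff, mem_clusterInEvent, Set.mem_compl_iff, mem_connEvent]
  constructor
  · rintro ⟨hU, hst⟩
    have hc : cluster ends (Function.update ω f true) s = cluster ends (Function.update ω f false) s := by
      ext x
      simp only [mem_cluster]
      exact conn_update_true_s_iff_of_not_conn hf ht' hs hpf1 hpin h0 h1 hst x
    exact ⟨hc ▸ hU, fun h => hst ((conn_update_true_s_t_iff hf ht' hs hpf1 hpin h0 h1).2 h)⟩
  · rintro ⟨hU, hso⟩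
    have hst : ¬ Conn ends (Function.update ω f true) s t := fun h => hso ((conn_update_true_s_t_iff hf ht' hs hpf1 hpin h0 h1).1 h)
    have hc : cluster ends (Function.update ω f true) s = cluster ends (Function.update ω f false) s := by
      ext x
      simp only [mem_cluster]
      exact conn_update_true_s_iff_of_not_conn hf ht' hs hpf1 hpin h0 h1 hst x
    exact ⟨hc ▸ hU, hst⟩

omit [IsStrictOrderedRing R] in
/-- With `f` open, `{C_s ∈ 𝓤} ∩ {o ∈ C_t} ∩ Q` is `{C_s ∈ 𝓤, s ↮ o}` of the closed world. -/
lemma tmark_oLU_one (p : E → R) (ends : E → Sym2 V) (s t t' o : V) (f : E)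
    (hf : ends f = s(t', o)) (ht' : Conn ends (fun e => decide (p e = 1)) t t')
    (hs : ¬ Conn ends (fun e => decide (p e = 1)) t s) (hpf1 : p f ≠ 1)
    (hpin : ∀ e, e ≠ f → (∃ v ∈ ends e, Conn ends (fun e => decide (p e = 1)) t v) →
      p e = 0 ∨ p e = 1) (𝓤 : Set (Set V)) :
    prob (Function.update p f 1) (clusterInEvent ends s 𝓤 ∩ clusterInEvent ends t {W : Set V | o ∈ W} ∩
      (connEvent ends s t)ᶜ) =
      prob (Function.update p f 0) (clusterInEvent ends s 𝓤 ∩ (connEvent ends s o)ᶜ) := by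
  refine prob_update_one_eq_prob_update_zero_of_respects p f fun ω h0 h1 => ?_
  simp only [Set.mem_inter_iff, mem_clusterInEvent, Set.mem_setOf_eq, mem_cluster,
    Set.mem_compl_iff, mem_connEvent]
  constructor
  · rintro ⟨⟨hU, _⟩, hst⟩
    have hc : cluster ends (Function.update ω f true) s = cluster ends (Function.update ω f false) s := by
      ext x
      simp only [mem_cluster]
      exact conn_update_true_s_iff_of_not_conn hf ht' hs hpf1 hpin h0 h1 hst x
    exact ⟨hc ▸ hU, fun h => hst ((conn_update_true_s_t_iff hf ht' hs hpf1 hpin h0 h1).2 h)⟩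
  · rintro ⟨hU, hso⟩
    have hst : ¬ Conn ends (Function.update ω f true) s t := fun h => hso ((conn_update_true_s_t_iff hf ht' hs hpf1 hpin h0 h1).1 h)
    have hc : cluster ends (Function.update ω f true) s = cluster ends (Function.update ω f false) s := by
      ext x
      simp only [mem_cluster]
      exact conn_update_true_s_iff_of_not_conn hf ht' hs hpf1 hpin h0 h1 hst x
    exact ⟨⟨hc ▸ hU, (conn_update_true_t_iff hf ht' hpf1 hpin h0 h1 o).2 (Or.inr (conn_refl _ _ _))⟩, hst⟩

/-- **(BERN_f) for the edge at the explored `t`-component reaching the mark `o`.** With `f = (t', o)`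
the only unpinned edge at the explored component (`t' ∈ Λ`, `s, o ∉ Λ`) and `𝓤` an up-set, the two
mixed Bernstein coefficients `T₁ = ∇Σ(M⁰)·M¹`, `T₂ = ∇Σ(M¹)·M⁰` of the (Ψ)-slack along `f` are
nonnegative: `T₁ = (Su·N − SuN)·UgN + (Ug·N − UgN)`, `T₂ = N·(N·Ug − UgN)` (mixed Harris). -/
theorem psi_bern_t_of_mark_o (p : E → R) (hp : IsProbVec p) (ends : E → Sym2 V) (s t t' o u : V) (f : E)
    (hf : ends f = s(t', o)) (ht' : Conn ends (fun e => decide (p e = 1)) t t')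
    (hs : ¬ Conn ends (fun e => decide (p e = 1)) t s)
    (ho : ¬ Conn ends (fun e => decide (p e = 1)) t o) (hpf1 : p f ≠ 1)
    (hpin : ∀ e, e ≠ f → (∃ v ∈ ends e, Conn ends (fun e => decide (p e = 1)) t v) →
      p e = 0 ∨ p e = 1) {𝓤 : Set (Set V)} (h𝓤 : IsUpperSet 𝓤) :
    0 ≤ (((prob (Function.update p f 0) (connEvent ends s t)ᶜ - prob (Function.update p f 0) (connEvent ends s u ∩ (connEvent ends s t)ᶜ)) * prob (Function.update p f 0) (clusterInEvent ends t {W : Set V | o ∈ W} ∩ (connEvent ends s t)ᶜ) +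
          prob (Function.update p f 0) (connEvent ends s t)ᶜ * (prob (Function.update p f 0) (connEvent ends s u ∩ clusterInEvent ends t {W : Set V | o ∈ W} ∩
          (connEvent ends s t)ᶜ) + prob (Function.update p f 0) (connEvent ends s u ∩ clusterInEvent ends s {W : Set V | o ∈ W} ∩
          (connEvent ends s t)ᶜ)) -
          prob (Function.update p f 0) (connEvent ends s u ∩ (connEvent ends s t)ᶜ) * prob (Function.update p f 0) (clusterInEvent ends s {W : Set V | o ∈ W} ∩ (connEvent ends s t)ᶜ)) * prob (Function.update p f 1) (clusterInEvent ends s 𝓤 ∩ (connEvent ends s t)ᶜ) +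
        (prob (Function.update p f 0) (clusterInEvent ends s 𝓤 ∩ (connEvent ends s t)ᶜ) * (prob (Function.update p f 0) (clusterInEvent ends t {W : Set V | o ∈ W} ∩ (connEvent ends s t)ᶜ) + prob (Function.update p f 0) (connEvent ends s u ∩ clusterInEvent ends t {W : Set V | o ∈ W} ∩
          (connEvent ends s t)ᶜ) + prob (Function.update p f 0) (connEvent ends s u ∩ clusterInEvent ends s {W : Set V | o ∈ W} ∩
          (connEvent ends s t)ᶜ)) -
          2 * prob (Function.update p f 0) (clusterInEvent ends s 𝓤 ∩ clusterInEvent ends t {W : Set V | o ∈ W} ∩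
          (connEvent ends s t)ᶜ) * prob (Function.update p f 0) (connEvent ends s t)ᶜ) * prob (Function.update p f 1) (connEvent ends s t)ᶜ +
        prob (Function.update p f 0) (clusterInEvent ends s 𝓤 ∩ (connEvent ends s t)ᶜ) * (prob (Function.update p f 0) (connEvent ends s t)ᶜ - prob (Function.update p f 0) (connEvent ends s u ∩ (connEvent ends s t)ᶜ)) * prob (Function.update p f 1) (clusterInEvent ends t {W : Set V | o ∈ W} ∩ (connEvent ends s t)ᶜ) -
        prob (Function.update p f 0) (clusterInEvent ends s 𝓤 ∩ (connEvent ends s t)ᶜ) * (prob (Function.update p f 0) (clusterInEvent ends t {W : Set V | o ∈ W} ∩ (connEvent ends s t)ᶜ) + prob (Function.update p f 0) (clusterInEvent ends s {W : Set V | o ∈ W} ∩ (connEvent ends s t)ᶜ)) * prob (Function.update p f 1) (connEvent ends s u ∩ (connEvent ends s t)ᶜ) +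
        prob (Function.update p f 0) (clusterInEvent ends s 𝓤 ∩ (connEvent ends s t)ᶜ) * prob (Function.update p f 0) (connEvent ends s t)ᶜ * (prob (Function.update p f 1) (connEvent ends s u ∩ clusterInEvent ends t {W : Set V | o ∈ W} ∩
          (connEvent ends s t)ᶜ) + prob (Function.update p f 1) (connEvent ends s u ∩ clusterInEvent ends s {W : Set V | o ∈ W} ∩
          (connEvent ends s t)ᶜ)) -
        prob (Function.update p f 0) (clusterInEvent ends s 𝓤 ∩ (connEvent ends s t)ᶜ) * prob (Function.update p f 0) (connEvent ends s u ∩ (connEvent ends s t)ᶜ) * prob (Function.update p f 1) (clusterInEvent ends s {W : Set V | o ∈ W} ∩ (connEvent ends s t)ᶜ) -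
        prob (Function.update p f 0) (connEvent ends s t)ᶜ * prob (Function.update p f 0) (connEvent ends s t)ᶜ * prob (Function.update p f 1) (clusterInEvent ends s 𝓤 ∩ clusterInEvent ends t {W : Set V | o ∈ W} ∩
          (connEvent ends s t)ᶜ)) ∧
    0 ≤ (((prob (Function.update p f 1) (connEvent ends s t)ᶜ - prob (Function.update p f 1) (connEvent ends s u ∩ (connEvent ends s t)ᶜ)) * prob (Function.update p f 1) (clusterInEvent ends t {W : Set V | o ∈ W} ∩ (connEvent ends s t)ᶜ) +
          prob (Function.update p f 1) (connEvent ends s t)ᶜ * (prob (Function.update p f 1) (connEvent ends s u ∩ clusterInEvent ends t {W : Set V | o ∈ W} ∩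
          (connEvent ends s t)ᶜ) + prob (Function.update p f 1) (connEvent ends s u ∩ clusterInEvent ends s {W : Set V | o ∈ W} ∩
          (connEvent ends s t)ᶜ)) -
          prob (Function.update p f 1) (connEvent ends s u ∩ (connEvent ends s t)ᶜ) * prob (Function.update p f 1) (clusterInEvent ends s {W : Set V | o ∈ W} ∩ (connEvent ends s t)ᶜ)) * prob (Function.update p f 0) (clusterInEvent ends s 𝓤 ∩ (connEvent ends s t)ᶜ) +
        (prob (Function.update p f 1) (clusterInEvent ends s 𝓤 ∩ (connEvent ends s t)ᶜ) * (prob (Function.update p f 1) (clusterInEvent ends t {W : Set V | o ∈ W} ∩ (connEvent ends s t)ᶜ) + prob (Function.update p f 1) (connEvent ends s u ∩ clusterInEvent ends t {W : Set V | o ∈ W} ∩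
          (connEvent ends s t)ᶜ) + prob (Function.update p f 1) (connEvent ends s u ∩ clusterInEvent ends s {W : Set V | o ∈ W} ∩
          (connEvent ends s t)ᶜ)) -
          2 * prob (Function.update p f 1) (clusterInEvent ends s 𝓤 ∩ clusterInEvent ends t {W : Set V | o ∈ W} ∩
          (connEvent ends s t)ᶜ) * prob (Function.update p f 1) (connEvent ends s t)ᶜ) * prob (Function.update p f 0) (connEvent ends s t)ᶜ +
        prob (Function.update p f 1) (clusterInEvent ends s 𝓤 ∩ (connEvent ends s t)ᶜ) * (prob (Function.update p f 1) (connEvent ends s t)ᶜ - prob (Function.update p f 1) (connEvent ends s u ∩ (connEvent ends s t)ᶜ)) * prob (Function.update p f 0) (clusterInEvent ends t {W : Set V | o ∈ W} ∩ (connEvent ends s t)ᶜ) -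
        prob (Function.update p f 1) (clusterInEvent ends s 𝓤 ∩ (connEvent ends s t)ᶜ) * (prob (Function.update p f 1) (clusterInEvent ends t {W : Set V | o ∈ W} ∩ (connEvent ends s t)ᶜ) + prob (Function.update p f 1) (clusterInEvent ends s {W : Set V | o ∈ W} ∩ (connEvent ends s t)ᶜ)) * prob (Function.update p f 0) (connEvent ends s u ∩ (connEvent ends s t)ᶜ) +
        prob (Function.update p f 1) (clusterInEvent ends s 𝓤 ∩ (connEvent ends s t)ᶜ) * prob (Function.update p f 1) (connEvent ends s t)ᶜ * (prob (Function.update p f 0) (connEvent ends s u ∩ clusterInEvent ends t {W : Set V | o ∈ W} ∩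
          (connEvent ends s t)ᶜ) + prob (Function.update p f 0) (connEvent ends s u ∩ clusterInEvent ends s {W : Set V | o ∈ W} ∩
          (connEvent ends s t)ᶜ)) -
        prob (Function.update p f 1) (clusterInEvent ends s 𝓤 ∩ (connEvent ends s t)ᶜ) * prob (Function.update p f 1) (connEvent ends s u ∩ (connEvent ends s t)ᶜ) * prob (Function.update p f 0) (clusterInEvent ends s {W : Set V | o ∈ W} ∩ (connEvent ends s t)ᶜ) -
        prob (Function.update p f 1) (connEvent ends s t)ᶜ * prob (Function.update p f 1) (connEvent ends s t)ᶜ * prob (Function.update p f 0) (clusterInEvent ends s 𝓤 ∩ clusterInEvent ends t {W : Set V | o ∈ W} ∩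
          (connEvent ends s t)ᶜ)) := by
  have hp0 : IsProbVec (Function.update p f 0) := hp.update f le_rfl zero_le_one
  have hω := tmark_pinned_eq p f hpf1
  -- the closed world: every edge at the explored component is pinned
  have hpin0 : ∀ e, (∃ v ∈ ends e, Conn ends (fun e => decide (Function.update p f 0 e = 1)) t v) →
      Function.update p f 0 e = 0 ∨ Function.update p f 0 e = 1 := by
    intro e he
    rw [hω] at he
    by_cases hef : e = f
    · subst hef
      exact Or.inl (by simp)
    · rw [Function.update_of_ne hef]
      exact hpin e hef he
  have hQ0 : prob (Function.update p f 0) (connEvent ends s t) = 0 := by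
    rw [connEvent_comm]
    exact prob_connEvent_eq_zero_of_explored _ ends hpin0 (by rw [hω]; exact hs)
  have ho0 : prob (Function.update p f 0) (connEvent ends t o) = 0 :=
    prob_connEvent_eq_zero_of_explored _ ends hpin0 (by rw [hω]; exact ho)
  have hq0 : prob (Function.update p f 0) (connEvent ends s t)ᶜ = 1 := by
    rw [prob_compl, hQ0, sub_zero]
  have hoL0 : prob (Function.update p f 0) (clusterInEvent ends t {W : Set V | o ∈ W}) = 0 := by
    rw [clusterInEvent_memFamily_eq_connEvent]; exact ho0
  -- the open world, in the closed world's terms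
  have e1 := tmark_q_one p ends s t t' o f hf ht' hs hpf1 hpin
  have e2 := tmark_oL_one p ends s t t' o f hf ht' hs hpf1 hpin
  have e3 := tmark_oH_one p ends s t t' o f hf ht' hs hpf1 hpin
  have e4 := tmark_aH_one p ends s t t' o u f hf ht' hs hpf1 hpin
  have e5 := tmark_oLH_one p ends s t t' o u f hf ht' hs hpf1 hpin
  have e6 := tmark_oHH_one p ends s t t' o u f hf ht' hs hpf1 hpin
  have e7 := tmark_Ug_one p ends s t t' o f hf ht' hs hpf1 hpin 𝓤
  have e8 := tmark_oLU_one p ends s t t' o f hf ht' hs hpf1 hpin 𝓤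
  rw [e1, e2, e3, e4, e5, e6, e7, e8, hq0]
  simp only [prob_inter_compl_of_eq_zero hp0 hQ0]
  rw [prob_inter_eq_zero_of_right hp0 hoL0, prob_inter_eq_zero_of_right hp0 hoL0, hoL0]
  -- the relations in the closed world
  have hSo : prob (Function.update p f 0) (clusterInEvent ends s {W : Set V | o ∈ W}) =
      1 - prob (Function.update p f 0) (connEvent ends s o)ᶜ := by
    rw [clusterInEvent_memFamily_eq_connEvent, prob_compl]; ring
  have hSS : prob (Function.update p f 0) (connEvent ends s u ∩ clusterInEvent ends s {W : Set V | o ∈ W}) =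
      prob (Function.update p f 0) (connEvent ends s u) -
        prob (Function.update p f 0) (connEvent ends s u ∩ (connEvent ends s o)ᶜ) := by
    rw [clusterInEvent_memFamily_eq_connEvent]
    have h := prob_inter_add_prob_inter_compl (Function.update p f 0) (connEvent ends s u)
      (connEvent ends s o)
    linarith
  rw [hSo, hSS]
  -- the two mixed Harris inequalities
  have hlow : IsLowerSet (connEvent ends s o)ᶜ := (isUpperSet_connEvent ends s o).compl
  have hC : prob (Function.update p f 0) (connEvent ends s u ∩ (connEvent ends s o)ᶜ) ≤
      prob (Function.update p f 0) (connEvent ends s u) *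
        prob (Function.update p f 0) (connEvent ends s o)ᶜ := by
    have h := prob_inter_le_prob_mul_prob_of_isLowerSet hp0 hlow (isUpperSet_connEvent ends s u)
    rw [Set.inter_comm, mul_comm] at h
    exact h
  have hH : prob (Function.update p f 0) (clusterInEvent ends s 𝓤 ∩ (connEvent ends s o)ᶜ) ≤
      prob (Function.update p f 0) (clusterInEvent ends s 𝓤) *
        prob (Function.update p f 0) (connEvent ends s o)ᶜ := by
    have h := prob_inter_le_prob_mul_prob_of_isLowerSet hp0 hlow (isUpperSet_clusterInEvent ends s h𝓤)
    rw [Set.inter_comm, mul_comm] at h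
    exact h
  have hN : 0 ≤ prob (Function.update p f 0) (connEvent ends s o)ᶜ := prob_nonneg hp0 _
  have hUgN : 0 ≤ prob (Function.update p f 0) (clusterInEvent ends s 𝓤 ∩ (connEvent ends s o)ᶜ) :=
    prob_nonneg hp0 _
  have k1 := mul_nonneg (sub_nonneg.2 hC) hUgN
  have k2 := sub_nonneg.2 hH
  have k3 := mul_nonneg hN k2
  constructor
  · nlinarith [k1, k2]
  · nlinarith [k3]

end TMark

end Summit.Ventures.PercRepro2
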